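import Mathlib
import HarnessLib

/-!
# Integrals of absolute values (Davis–Rabinowitz 1984, Sect. 2.12.9)

**Source.** P. J. Davis, P. Rabinowitz, *Methods of Numerical Integration* (2nd ed., Academic Press, 1984),
Sect. 2.12.9 "Integrals of Absolute Values" (p. 186).

**Statement.** Integrands `|f(x)|` occur frequently. If `f` does not change sign over the interval of
integration then `∫ |f| = ± ∫ f` and one is in the usual case. If `f` changes sign at `x₀`, the continuity
class may be lowered when the absolute value is taken: `(x − x₀)^{2n+1}` is `C^∞` while `|(x − x₀)^{2n+1}|`
lacks a `(2n+1)`th derivative at `x₀`. The advice is to locate the zeros of `f` and to integrate between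
them; otherwise a sequence of ordinary rules converges slowly. Example:
`∫_{-1}^{1} |(x² − 1/4)(x − 1/4)| dx = 503/1536 = .3274739583`, for which the Gauss rules give
`G₃₆ = .32798767, G₄₈ = .32776175, G₆₄ = .32753771, G₉₆ = .32753845` — "convergence is bad, especially
from 64 to 96".

**What is typed** (all PROVED, Mathlib only):
* `integral_abs_of_nonneg_on` / `integral_abs_of_nonpos_on` — the sign-constant case `∫ |f| = ± ∫ f`;
* `integral_abs_split_nonpos_nonneg` / `integral_abs_split_nonneg_nonpos` — integrating between the zeros:
  one sign change at `x₀`; `integral_abs_eq_sum_abs_pieces` — finitely many pieces `z₀ ≤ z₁ ≤ ⋯ ≤ z_k` on each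
  of which `f` keeps a sign: `∫_{z₀}^{z_k} |f| = Σ_i |∫_{z_i}^{z_{i+1}} f|`;
* the lowered continuity class for `n = 0`: `contDiff_sub_pow_odd` (`(x − x₀)^{2n+1}` is `C^∞`),
  `abs_sub_pow_odd` (`|(x − x₀)^{2n+1}| = (x − x₀)^{2n} |x − x₀|`) and `not_differentiableAt_abs_sub`
  (`|x − x₀|` is not differentiable at `x₀`);
* the worked example, certified exactly: `dr2129Integrand`, its primitive, the four sign regimes split at the
  zeros `−1/2, 1/4, 1/2`, and `integral_abs_dr2129Integrand : ∫_{-1}^{1} |(x² − 1/4)(x − 1/4)| dx = 503/1536`,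
  with the decimal `.3274739583` (`dr2129_decimal`); the text's four Gauss-rule values are recorded as REPORTED
  data (`dr2129ReportedGauss`, not recomputed here) together with the arithmetic behind "convergence is bad":
  the reported error at `n = 96` exceeds the one at `n = 64` (`dr2129_reported_errors`).

Not typed: the general non-existence of the `(2n+1)`th derivative of `|(x − x₀)^{2n+1}|` for `n ≥ 1`, the
complex-modulus remark, and the asymptotics of Sect. 4.6.1.

References: [cite: DavisRabinowitz1984, Sect. 2.12.9].
-/

noncomputable section

open Real Set MeasureTheory intervalIntegral Finset

namespace Literature.Analysis.Quadrature

/-! ## The sign-constant case -/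

/-- If `f ≥ 0` on `[a, b]` then `∫_a^b |f| = ∫_a^b f`. [cite: DavisRabinowitz1984, Sect. 2.12.9] -/
theorem integral_abs_of_nonneg_on {f : ℝ → ℝ} {a b : ℝ} (hab : a ≤ b) (hf : ∀ x ∈ Icc a b, 0 ≤ f x) :
    ∫ x in a..b, |f x| = ∫ x in a..b, f x :=
  integral_congr fun x hx => abs_of_nonneg (hf x (by rwa [uIcc_of_le hab] at hx))

/-- If `f ≤ 0` on `[a, b]` then `∫_a^b |f| = -∫_a^b f`. [cite: DavisRabinowitz1984, Sect. 2.12.9] -/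
theorem integral_abs_of_nonpos_on {f : ℝ → ℝ} {a b : ℝ} (hab : a ≤ b) (hf : ∀ x ∈ Icc a b, f x ≤ 0) :
    ∫ x in a..b, |f x| = -∫ x in a..b, f x := by
  rw [← intervalIntegral.integral_neg]
  exact integral_congr fun x hx => abs_of_nonpos (hf x (by rwa [uIcc_of_le hab] at hx))

/-- "If `f` does not change sign over the interval of integration, then `∫ |f| = ± ∫ f`."
[cite: DavisRabinowitz1984, Sect. 2.12.9] -/
theorem integral_abs_of_sign_constant {f : ℝ → ℝ} {a b : ℝ} (hab : a ≤ b)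
    (hf : (∀ x ∈ Icc a b, 0 ≤ f x) ∨ (∀ x ∈ Icc a b, f x ≤ 0)) :
    ∫ x in a..b, |f x| = |∫ x in a..b, f x| := by
  rcases hf with hf | hf
  · rw [integral_abs_of_nonneg_on hab hf, abs_of_nonneg (integral_nonneg hab hf)]
  · rw [integral_abs_of_nonpos_on hab hf, abs_of_nonpos]
    have : ∫ x in a..b, -f x = -∫ x in a..b, f x := intervalIntegral.integral_neg
    have h0 : 0 ≤ ∫ x in a..b, -f x := integral_nonneg hab fun x hx => neg_nonneg.mpr (hf x hx)
    linarith

/-! ## Integrating between the zeros -/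

/-- One sign change at `x₀ ∈ [a, b]`, `f ≤ 0` before and `f ≥ 0` after:
`∫_a^b |f| = -∫_a^{x₀} f + ∫_{x₀}^b f`. [cite: DavisRabinowitz1984, Sect. 2.12.9] -/
theorem integral_abs_split_nonpos_nonneg {f : ℝ → ℝ} {a x₀ b : ℝ} (h₁ : a ≤ x₀) (h₂ : x₀ ≤ b)
    (hi₁ : IntervalIntegrable f volume a x₀) (hi₂ : IntervalIntegrable f volume x₀ b)
    (hneg : ∀ x ∈ Icc a x₀, f x ≤ 0) (hpos : ∀ x ∈ Icc x₀ b, 0 ≤ f x) :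
    ∫ x in a..b, |f x| = -(∫ x in a..x₀, f x) + ∫ x in x₀..b, f x := by
  rw [← integral_add_adjacent_intervals hi₁.abs hi₂.abs, integral_abs_of_nonpos_on h₁ hneg,
    integral_abs_of_nonneg_on h₂ hpos]

/-- One sign change at `x₀ ∈ [a, b]`, `f ≥ 0` before and `f ≤ 0` after:
`∫_a^b |f| = ∫_a^{x₀} f - ∫_{x₀}^b f`. [cite: DavisRabinowitz1984, Sect. 2.12.9] -/
theorem integral_abs_split_nonneg_nonpos {f : ℝ → ℝ} {a x₀ b : ℝ} (h₁ : a ≤ x₀) (h₂ : x₀ ≤ b)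
    (hi₁ : IntervalIntegrable f volume a x₀) (hi₂ : IntervalIntegrable f volume x₀ b)
    (hpos : ∀ x ∈ Icc a x₀, 0 ≤ f x) (hneg : ∀ x ∈ Icc x₀ b, f x ≤ 0) :
    ∫ x in a..b, |f x| = (∫ x in a..x₀, f x) - ∫ x in x₀..b, f x := by
  rw [← integral_add_adjacent_intervals hi₁.abs hi₂.abs, integral_abs_of_nonneg_on h₁ hpos,
    integral_abs_of_nonpos_on h₂ hneg, sub_eq_add_neg]

/-- **Locate the zeros and integrate between them.** If `z₀ ≤ z₁ ≤ ⋯ ≤ z_k` and `f` keeps a constant sign on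
each `[z_i, z_{i+1}]`, then `∫_{z₀}^{z_k} |f| = Σ_{i<k} |∫_{z_i}^{z_{i+1}} f|` — each piece an integral of a smooth
integrand when `f` is smooth. [cite: DavisRabinowitz1984, Sect. 2.12.9] -/
theorem integral_abs_eq_sum_abs_pieces {f : ℝ → ℝ} (z : ℕ → ℝ) (k : ℕ)
    (hz : ∀ i < k, z i ≤ z (i + 1)) (hint : ∀ i < k, IntervalIntegrable f volume (z i) (z (i + 1)))
    (hsign : ∀ i < k, (∀ x ∈ Icc (z i) (z (i + 1)), 0 ≤ f x) ∨ (∀ x ∈ Icc (z i) (z (i + 1)), f x ≤ 0)) :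
    ∫ x in z 0..z k, |f x| = ∑ i ∈ Finset.range k, |∫ x in z i..z (i + 1), f x| := by
  rw [← sum_integral_adjacent_intervals fun i hi => (hint i hi).abs]
  refine sum_congr rfl fun i hi => ?_
  rw [Finset.mem_range] at hi
  exact integral_abs_of_sign_constant (hz i hi) (hsign i hi)

/-! ## The continuity class is lowered -/

/-- `(x − x₀)^{2n+1}` is of class `C^∞`. [cite: DavisRabinowitz1984, Sect. 2.12.9] -/
theorem contDiff_sub_pow_odd (x₀ : ℝ) (n : ℕ) : ContDiff ℝ ⊤ (fun x : ℝ => (x - x₀) ^ (2 * n + 1)) :=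
  (contDiff_id.sub contDiff_const).pow _

/-- `|(x − x₀)^{2n+1}| = (x − x₀)^{2n} · |x − x₀|`: the absolute value only bites through the last factor.
[cite: DavisRabinowitz1984, Sect. 2.12.9] -/
theorem abs_sub_pow_odd (x₀ x : ℝ) (n : ℕ) :
    |(x - x₀) ^ (2 * n + 1)| = (x - x₀) ^ (2 * n) * |x - x₀| := by
  rw [abs_pow, pow_succ, Even.pow_abs ⟨n, two_mul n⟩]

/-- For `n = 0`: `|x − x₀|` has no first derivative at `x₀` (while `x − x₀` is `C^∞`).
[cite: DavisRabinowitz1984, Sect. 2.12.9] -/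
theorem not_differentiableAt_abs_sub (x₀ : ℝ) : ¬ DifferentiableAt ℝ (fun x : ℝ => |x - x₀|) x₀ := by
  intro h
  apply not_differentiableAt_abs_zero
  have h' : DifferentiableAt ℝ (fun x : ℝ => |x - x₀|) (0 + x₀) := by simpa using h
  have hc : DifferentiableAt ℝ ((fun x : ℝ => |x - x₀|) ∘ fun y : ℝ => y + x₀) 0 :=
    h'.comp 0 (differentiableAt_id.add (differentiableAt_const x₀))
  have : ((fun x : ℝ => |x - x₀|) ∘ fun y : ℝ => y + x₀) = (abs : ℝ → ℝ) := by
    funext y; simp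
  rwa [this] at hc

/-! ## The worked example `∫_{-1}^{1} |(x² − 1/4)(x − 1/4)| dx = 503/1536` -/

/-- The example's integrand `(x² − 1/4)(x − 1/4)`, with zeros at `−1/2, 1/4, 1/2`.
[cite: DavisRabinowitz1984, Sect. 2.12.9] -/
def dr2129Integrand (x : ℝ) : ℝ := (x ^ 2 - 1 / 4) * (x - 1 / 4)

/-- A primitive of the example's integrand: `x⁴/4 − x³/12 − x²/8 + x/16`.
[cite: DavisRabinowitz1984, Sect. 2.12.9] -/
def dr2129Primitive (x : ℝ) : ℝ := x ^ 4 / 4 - x ^ 3 / 12 - x ^ 2 / 8 + x / 16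

/-- The integrand is continuous. [cite: DavisRabinowitz1984, Sect. 2.12.9] -/
theorem continuous_dr2129Integrand : Continuous dr2129Integrand := by
  unfold dr2129Integrand; fun_prop

/-- `dr2129Primitive' = dr2129Integrand`. [cite: DavisRabinowitz1984, Sect. 2.12.9] -/
theorem hasDerivAt_dr2129Primitive (x : ℝ) : HasDerivAt dr2129Primitive (dr2129Integrand x) x := by
  have h4 : HasDerivAt (fun x : ℝ => x ^ 4) (4 * x ^ 3) x := by simpa using hasDerivAt_pow 4 x
  have h3 : HasDerivAt (fun x : ℝ => x ^ 3) (3 * x ^ 2) x := by simpa using hasDerivAt_pow 3 x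
  have h2 : HasDerivAt (fun x : ℝ => x ^ 2) (2 * x) x := by simpa using hasDerivAt_pow 2 x
  have h1 : HasDerivAt (fun x : ℝ => x) 1 x := hasDerivAt_id x
  have h := (((h4.div_const 4).sub (h3.div_const 12)).sub (h2.div_const 8)).add (h1.div_const 16)
  have hval : 4 * x ^ 3 / 4 - 3 * x ^ 2 / 12 - 2 * x / 8 + 1 / 16 = dr2129Integrand x := by
    unfold dr2129Integrand; ring
  rw [← hval]
  exact h

/-- The integral of the example's integrand over any interval, by the fundamental theorem of calculus.
[cite: DavisRabinowitz1984, Sect. 2.12.9] -/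
theorem integral_dr2129Integrand (a b : ℝ) :
    ∫ x in a..b, dr2129Integrand x = dr2129Primitive b - dr2129Primitive a :=
  integral_eq_sub_of_hasDerivAt (fun x _ => hasDerivAt_dr2129Primitive x)
    (continuous_dr2129Integrand.intervalIntegrable a b)

/-- Sign regime 1: the integrand is `≤ 0` on `[-1, -1/2]`. [cite: DavisRabinowitz1984, Sect. 2.12.9] -/
theorem dr2129Integrand_nonpos_left {x : ℝ} (hx : x ∈ Icc (-1 : ℝ) (-1 / 2)) : dr2129Integrand x ≤ 0 := by
  obtain ⟨-, h2⟩ := hx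
  unfold dr2129Integrand
  exact mul_nonpos_of_nonneg_of_nonpos (by nlinarith) (by linarith)

/-- Sign regime 2: the integrand is `≥ 0` on `[-1/2, 1/4]`. [cite: DavisRabinowitz1984, Sect. 2.12.9] -/
theorem dr2129Integrand_nonneg_midleft {x : ℝ} (hx : x ∈ Icc (-1 / 2 : ℝ) (1 / 4)) :
    0 ≤ dr2129Integrand x := by
  obtain ⟨h1, h2⟩ := hx
  unfold dr2129Integrand
  exact mul_nonneg_of_nonpos_of_nonpos (by nlinarith) (by linarith)

/-- Sign regime 3: the integrand is `≤ 0` on `[1/4, 1/2]`. [cite: DavisRabinowitz1984, Sect. 2.12.9] -/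
theorem dr2129Integrand_nonpos_midright {x : ℝ} (hx : x ∈ Icc (1 / 4 : ℝ) (1 / 2)) :
    dr2129Integrand x ≤ 0 := by
  obtain ⟨h1, h2⟩ := hx
  unfold dr2129Integrand
  exact mul_nonpos_of_nonpos_of_nonneg (by nlinarith) (by linarith)

/-- Sign regime 4: the integrand is `≥ 0` on `[1/2, 1]`. [cite: DavisRabinowitz1984, Sect. 2.12.9] -/
theorem dr2129Integrand_nonneg_right {x : ℝ} (hx : x ∈ Icc (1 / 2 : ℝ) 1) : 0 ≤ dr2129Integrand x := by
  obtain ⟨h1, -⟩ := hx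
  unfold dr2129Integrand
  exact mul_nonneg (by nlinarith) (by linarith)

/-- **The example, certified exactly**: splitting at the zeros `−1/2, 1/4, 1/2`,
`∫_{-1}^{1} |(x² − 1/4)(x − 1/4)| dx = 503/1536`. [cite: DavisRabinowitz1984, Sect. 2.12.9] -/
theorem integral_abs_dr2129Integrand : ∫ x in (-1 : ℝ)..1, |dr2129Integrand x| = 503 / 1536 := by
  have hi : ∀ a b : ℝ, IntervalIntegrable (fun x => |dr2129Integrand x|) volume a b := fun a b =>
    (continuous_dr2129Integrand.intervalIntegrable a b).abs
  rw [← integral_add_adjacent_intervals (hi (-1) (-1 / 2)) (hi (-1 / 2) 1),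
    ← integral_add_adjacent_intervals (hi (-1 / 2) (1 / 4)) (hi (1 / 4) 1),
    ← integral_add_adjacent_intervals (hi (1 / 4) (1 / 2)) (hi (1 / 2) 1),
    integral_abs_of_nonpos_on (by norm_num) fun x hx => dr2129Integrand_nonpos_left hx,
    integral_abs_of_nonneg_on (by norm_num) fun x hx => dr2129Integrand_nonneg_midleft hx,
    integral_abs_of_nonpos_on (by norm_num) fun x hx => dr2129Integrand_nonpos_midright hx,
    integral_abs_of_nonneg_on (by norm_num) fun x hx => dr2129Integrand_nonneg_right hx]
  simp only [integral_dr2129Integrand, dr2129Primitive]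
  norm_num

/-- Without splitting, the sign-blind value `∫_{-1}^{1} (x² − 1/4)(x − 1/4) dx = -1/24` is of course not the
integral of the absolute value. [cite: DavisRabinowitz1984, Sect. 2.12.9] -/
theorem integral_dr2129Integrand_unit : ∫ x in (-1 : ℝ)..1, dr2129Integrand x = -1 / 24 := by
  rw [integral_dr2129Integrand]; unfold dr2129Primitive; norm_num

/-- The decimal value quoted in the text: `503/1536 = .3274739583…`. [cite: DavisRabinowitz1984, Sect. 2.12.9] -/
theorem dr2129_decimal : |(503 / 1536 : ℝ) - 0.3274739583| < 1e-10 := by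
  rw [abs_lt]; constructor <;> norm_num

/-- The Gauss-rule values REPORTED in the text for this integrand (pairs `(n, G_n)`; recorded as data, not
recomputed here): `G₃₆ = .32798767, G₄₈ = .32776175, G₆₄ = .32753771, G₉₆ = .32753845`.
[cite: DavisRabinowitz1984, Sect. 2.12.9] -/
def dr2129ReportedGauss : List (ℕ × ℝ) :=
  [(36, 0.32798767), (48, 0.32776175), (64, 0.32753771), (96, 0.32753845)]

/-- "Convergence is bad, especially from 64 to 96": against the exact value `503/1536` the reported errors are
about `5.1·10⁻⁴, 2.9·10⁻⁴, 6.4·10⁻⁵, 6.4·10⁻⁵` — the reported `n = 96` value is even slightly farther from the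
truth than the `n = 64` value. [cite: DavisRabinowitz1984, Sect. 2.12.9] -/
theorem dr2129_reported_errors :
    (5e-4 : ℝ) < 0.32798767 - 503 / 1536 ∧ (0.32798767 - 503 / 1536 : ℝ) < 5.2e-4 ∧
    (6e-5 : ℝ) < 0.32753771 - 503 / 1536 ∧ (0.32753771 - 503 / 1536 : ℝ) < 0.32753845 - 503 / 1536 ∧
    (0.32753845 - 503 / 1536 : ℝ) < 6.5e-5 := by
  refine ⟨?_, ?_, ?_, ?_, ?_⟩ <;> norm_num

end Literature.Analysis.Quadrature

end
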